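/-
Copyright (c) 2026 the pub-hodgecm-mathlib formalisation cell (harness21).  Prover seat hodgecm-mathlib-LH4-p07 (g8), req620 Track A «(D-RAM) FOUR-FRAME» squad
(STAGE-1b, heir dealer∕pen LH4-plan (g13) WORD #51 (1): NAMED «(T5-P-axis)»; row-(2) lead), 2026-09-04.
-/
import Summits.HodgeConjecture.HodgeConjecture.Theorems.F0P3cDyRamJointProfileCensusIndicatorLetter     -- ★ p859363 (this seat): indicator letters; brings ★ (α) `isOrd_pow_iff_le`
import Summits.HodgeConjecture.HodgeConjecture.Theorems.F0P3cDyRamToricLevelCensusRamKAtThirdField      -- ★ p858020 (LH4-p07 (g7)): `ncard_levelSet_ramK_hyper∕aniso_of_frame` (T5b RamK tables, frame-packaged)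
import Summits.HodgeConjecture.HodgeConjecture.Theorems.F0P3cDyRamToricLevelCensusUnrAtThirdField       -- ★ (LH4-p08): `ncard_levelSet_unr_hyper∕aniso_of_frame` (T5a Unr tables, frame-packaged)
import Summits.HodgeConjecture.HodgeConjecture.Theorems.F0P3cDyRamToricLevelCensusRamMTables           -- ★ (LH4-p04 (g5)): `ncard_levelSet_eq_hnP` (T5c RamM table, hyperbolic∕`hnP` package)
import Summits.HodgeConjecture.HodgeConjecture.Theorems.F0P3cDyRamToricLevelCensusRamMTablesAniso      -- ★ (LH4-p04 (g5)): `ncard_levelSet_eq_hnM` (T5c RamM table, anisotropic∕`hnM` package)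
import HarnessLib

/-!
# Crux `H413`, line LH4 «(D-RAM) FOUR-FRAME» — STAGE-1b, row (2): (T5-P-axis) «THE AXIS TERM OF THE `lev_{a,m}` CENSUS: INDICATOR COLLAPSE AND THE a = 0 TABLES SUMMED, PER TYPE»
# `Σ_{j ≤ J} [lam, (lam−1)∕c, (lam−1)²∕c′ ∈ 𝒪_j]·g j = Σ_{j ≤ J′} g j`,  `J′ = min(jλ − a, jλ + n − b)`;  `Σ_{j ≤ J′} #levelSet(j,0) = Σ_{j ≤ J′} row⁰_type(j)` (RamK ∕ Unr ∕ RamM, both sides)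

Cell `hodgecm-mathlib` (D-0151), FLOOR 0, crux item H413 = `stmt-HodgeConjecture-24833`, route of record `HCCMUnconditional`; squad F0∕P3c∕LH4; lane
`--supports stmt-HodgeConjecture-24833 --as helper` (count-neutral; pays NO tier-0 row).  THEOREMS ONLY (no `def`, no instance, no notation, no `sorry`).  NAMED by heir dealer
LH4-plan (g13) WORD #51 (1) as «(T5-P-axis)»; SIG sheet `F0/P3c/LH4/LH4-p07/g8/SIG-T5P-axis.v1.LH4p07g8.md` (53788de8).  Consumers: the directive's (C2) template instances
(pieces `sq_{m*}`, `lev_{ℓ₀+1,m*}`, `lev_{ℓ₀,m_c}`, `lev_{ℓ₀+1,m_c}`; LH4-p04 (g7) (C2-lev-m_c)).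

THE OBJECT.  The AXIS TERM of the row-(2) census of a template piece `lev_{a,m}` (★ p859229 `ncard_fixed_selfDual_endoGL_lev_sq_eq_orderForm`) is
`AX = Σ_{j ∈ range (J+1)} [IsOrd_j lam ∧ IsOrd_j (c⁻¹(lam − 1)) ∧ IsOrd_j (c′⁻¹(lam − 1)²)]·#levelSet(j, 0)` (`c = jE ϖ^a`, `c′ = jE ϖ^m`).
* §1 TYPE-FREE COLLAPSE.  With the tokens `|lam − ρlam| = |ϖE|^{jλ}|α − ρα|`, `|c| = |ϖE|^a`, `|c′| = |ϖE|^b`, `|lam + ρlam − 2| = |ϖE|^n` and the level conditions `|lam − 1| ≤ |c|`,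
  `|(lam − 1)²| ≤ |c′|` (`a ≤ jλ`, `b ≤ jλ + n`, `jλ ≤ J`), ★ (α) `isOrd_pow_iff_le` and ★ p859363's indicator letters turn the three clauses into `j ≤ jλ`, `j ≤ jλ − a`, `j ≤ jλ + n − b`,
  so for ANY summand `g`: `Σ_{j ∈ range (J+1)} [·]·g j = Σ_{j ∈ range (J′+1)} g j`, `J′ := min(jλ − a, jλ + n − b)` (`sum_ite_isOrd₃_eq_sum_range`); if a level condition fails the sum is `0`
  (`…_eq_zero_of_lt`, `…_eq_zero_of_lt_sq`, ★ p859363 `not_isOrd_inv_mul_of_lt`).  READING: the `lev_{a,m}` axis is the UNIT piece's axis sum `Σ_j #levelSet(j,0)` TRUNCATED at `J′`.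
* §2 THE a = 0 TABLES SUMMED, PER THIRD-FIELD TYPE AND SIDE — hypothesis packages VERBATIM from the cited ★ tables, conclusions `Σ_{j<J′+1} #levelSet(j,0) = Σ_{j<J′+1} row⁰(j)` with the
  a = 0 row written out: RamK (★ `ncard_levelSet_ramK_hyper∕aniso_of_frame`), Unr (★ `ncard_levelSet_unr_hyper∕aniso_of_frame`), RamM (★ `ncard_levelSet_eq_hnP ∕ _eq_hnM`).
The composition §1 ∘ §2 (`AX = Σ_{j<J′+1} row⁰_type(j)`) and the geometric evaluation are the sequel (`…AxisClosedForm`).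
HONEST LABEL.  Count-neutral arithmetic over ★ organs; nothing printed is asserted; no census law is stated; `HC_CM` is proved only modulo the 7 printed citations (2 remaining named inputs:
hLiu418 = `stmt-HodgeConjecture-24832`, h413 = `stmt-HodgeConjecture-24833`) until rung 0 closes.

## References
* [Kottwitz1986BaseChangeUnits] R. E. Kottwitz, *Base change for unit elements of Hecke algebras*, Compositio Math. 60 (1986): §1 pp. 240–241.
* [Flicker1998UnitaryFL] Y. Z. Flicker, *Elementary proof of the fundamental lemma for a unitary group*, Canad. J. Math. 50 (1998): Prop. 7 p. 84 (the level tables).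
* [Jacobowitz1962] R. Jacobowitz, *Hermitian forms over local fields*, Amer. J. Math. 84 (1962): §4, §7.
* [Serre1979] J.-P. Serre, *Local Fields*, GTM 67 (1979): Ch. III §6 Prop. 12; Ch. V §1–§3.
-/

set_option autoImplicit false

noncomputable section

open WithZero IsLocalRing
open scoped Valued
open Literature.NumberTheory.Automorphic.UnitaryThreeFourFrame (IsRamifiedQuadraticDatum)
open Summit.HodgeConjecture.HodgeConjecture.Cruxes.H413.F0P3cDyRamToricCensusDefs
open Summit.HodgeConjecture.HodgeConjecture.Cruxes.H413.F0P3cDyRamOrderFiltrationRange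
open Summit.HodgeConjecture.HodgeConjecture.Cruxes.H413.F0P3cDyRamJointProfileCensusIndicatorLetter
open Summit.HodgeConjecture.HodgeConjecture.Cruxes.H413.F0P3cDyRamToricLevelCensusRamKAtThirdField
open Summit.HodgeConjecture.HodgeConjecture.Cruxes.H413.F0P3cDyRamToricLevelCensusUnrAtThirdField
open Summit.HodgeConjecture.HodgeConjecture.Cruxes.H413.F0P3cDyRamToricLevelCensusRamM

namespace Summit.HodgeConjecture.HodgeConjecture.Cruxes.H413.F0P3cDyRamJointProfileCensusAxisTables

variable {K : Type} [Field K] [Valued K ℤᵐ⁰] {ρ Θ : K →+* K} {α ϖE h : K}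

/-! ## §1 Type-free collapse of the three-clause indicator -/

open scoped Classical in
/-- **(T5-P-axis) THE THREE-CLAUSE INDICATOR TRUNCATES AT `J′ = min(jλ − a, jλ + n − b)`** (any summand `g`).  Tokens: `ρα ≠ α`; `0 < |ϖE| < 1`; `|lam| ≤ 1`,
`|lam − ρlam| = |ϖE|^{jλ}·|α − ρα|`; `ρc = c`, `|c| = |ϖE|^a`, `|lam − 1| ≤ |c|`, `a ≤ jλ`; `ρc′ = c′`, `|c′| = |ϖE|^b`, `|(lam − 1)²| ≤ |c′|`, `|lam + ρlam − 2| = |ϖE|^n`, `b ≤ jλ + n`; `jλ ≤ J`.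
[cite: Kottwitz1986BaseChangeUnits, §1 pp. 240–241] [cite: Flicker1998UnitaryFL, Prop. 7 p. 84] -/
theorem sum_ite_isOrd₃_eq_sum_range {N : Type*} [AddCommMonoid N] (hα : ρ α ≠ α) (hϖ0 : ϖE ≠ 0) (hϖ1 : Valued.v ϖE < 1)
    {lam : K} (hlam1 : Valued.v lam ≤ 1) {jl : ℕ} (hjl : Valued.v (lam - ρ lam) = Valued.v ϖE ^ jl * Valued.v (α - ρ α))
    {c : K} (hρc : ρ c = c) {a : ℕ} (hc : Valued.v c = Valued.v ϖE ^ a) (hlev : Valued.v (lam - 1) ≤ Valued.v c) (hajl : a ≤ jl)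
    {c' : K} (hρc' : ρ c' = c') {b : ℕ} (hc' : Valued.v c' = Valued.v ϖE ^ b) (hlev2 : Valued.v ((lam - 1) * (lam - 1)) ≤ Valued.v c')
    {n : ℕ} (hn : Valued.v (lam + ρ lam - 2) = Valued.v ϖE ^ n) (hb : b ≤ jl + n) {J : ℕ} (hJ : jl ≤ J) (g : ℕ → N) :
    ∑ j ∈ Finset.range (J + 1),
        (if IsOrd ρ α (ϖE ^ j) lam ∧ IsOrd ρ α (ϖE ^ j) (c⁻¹ * (lam - 1)) ∧ IsOrd ρ α (ϖE ^ j) (c'⁻¹ * ((lam - 1) * (lam - 1))) then g j else 0) =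
      ∑ j ∈ Finset.range (min (jl - a) (jl + n - b) + 1), g j := by
  have hiff : ∀ j, (IsOrd ρ α (ϖE ^ j) lam ∧ IsOrd ρ α (ϖE ^ j) (c⁻¹ * (lam - 1)) ∧ IsOrd ρ α (ϖE ^ j) (c'⁻¹ * ((lam - 1) * (lam - 1)))) ↔
      j ≤ min (jl - a) (jl + n - b) := fun j => by
    rw [isOrd_pow_iff_le hα hϖ0 hϖ1 hlam1 hjl j, isOrd_pow_inv_mul_sub_one_iff_le hα hϖ0 hϖ1 hρc hc hlev hjl hajl j,
      isOrd_pow_inv_mul_sub_one_sq_iff_le hα hϖ0 hϖ1 hρc' hc' hlev2 hjl hn hb j, le_min_iff]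
    omega
  simp_rw [hiff]
  rw [← Finset.sum_filter]
  congr 1
  ext j
  simp only [Finset.mem_filter, Finset.mem_range]
  omega

open scoped Classical in
/-- **Level condition violated ⇒ the axis vanishes**: if `|c| < |lam − 1|` the depth clause fails at every `j` (★ p859363 `not_isOrd_inv_mul_of_lt`). [cite: Serre1979, Ch. III §6 Prop. 12] -/
theorem sum_ite_isOrd₃_eq_zero_of_lt {N : Type*} [AddCommMonoid N] {lam c : K} (hc0 : c ≠ 0) (hlt : Valued.v c < Valued.v (lam - 1)) (c' : K)
    (s : Finset ℕ) (g : ℕ → N) :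
    ∑ j ∈ s, (if IsOrd ρ α (ϖE ^ j) lam ∧ IsOrd ρ α (ϖE ^ j) (c⁻¹ * (lam - 1)) ∧ IsOrd ρ α (ϖE ^ j) (c'⁻¹ * ((lam - 1) * (lam - 1))) then g j else 0) = 0 :=
  Finset.sum_eq_zero fun j _ => by
    rw [if_neg]
    exact fun h3 => not_isOrd_inv_mul_of_lt (ρ := ρ) (α := α) hc0 hlt (ϖE ^ j) h3.2.1

open scoped Classical in
/-- **Square level condition violated ⇒ the axis vanishes**: if `|c′| < |(lam − 1)²|` the square clause fails at every `j`. [cite: Serre1979, Ch. III §6 Prop. 12] -/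
theorem sum_ite_isOrd₃_eq_zero_of_lt_sq {N : Type*} [AddCommMonoid N] {lam c' : K} (hc0 : c' ≠ 0) (hlt : Valued.v c' < Valued.v ((lam - 1) * (lam - 1)))
    (c : K) (s : Finset ℕ) (g : ℕ → N) :
    ∑ j ∈ s, (if IsOrd ρ α (ϖE ^ j) lam ∧ IsOrd ρ α (ϖE ^ j) (c⁻¹ * (lam - 1)) ∧ IsOrd ρ α (ϖE ^ j) (c'⁻¹ * ((lam - 1) * (lam - 1))) then g j else 0) = 0 :=
  Finset.sum_eq_zero fun j _ => by
    rw [if_neg]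
    exact fun h3 => not_isOrd_inv_mul_of_lt (ρ := ρ) (α := α) hc0 hlt (ϖE ^ j) h3.2.2

/-! ## §2 The a = 0 tables summed, per third-field type and side -/

/-- **(T5-P-axis) TYPE RamK, HYPERBOLIC SIDE** — the a = 0 row of ★ `ncard_levelSet_ramK_hyper_of_frame` summed to `J′`: `row⁰(j) = [j = 0] + [j ≥ 2 even]·(2 if 2d ≤ j+1 else 1)·q^{j∕2}`. [cite: Flicker1998UnitaryFL, Prop. 7 p. 84] [cite: Jacobowitz1962, §7] -/
theorem sum_ncard_levelSet_zero_eq_ramK_hyper [CompleteSpace K] [IsDiscreteValuationRing 𝒪[K]] [Finite 𝓀[K]]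
    (hρρ : ∀ x, ρ (ρ x) = x) (hvρ : ∀ x, Valued.v (ρ x) = Valued.v x) (hΘρ : ∀ x, Θ (ρ x) = ρ (Θ x))
    (hα1 : Valued.v α ≤ 1) (hα : Valued.v (α - ρ α) = 1) {d t : ℕ} (hD : IsRamifiedQuadraticDatum Θ ϖE d t) (hρϖ : ρ ϖE = ϖE)
    (hΘh : Θ h = h) (hh : h ≠ 0) {q : ℕ} (hq : Nat.card 𝓀[K] = q ^ 2)
    (hσres : ∀ z : K, ρ z = z → Valued.v z ≤ 1 → Valued.v (Θ z - z) < 1) (hram : Valued.v (α - Θ α) < 1)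
    (hhyper : ∃ x : K, x ≠ 0 ∧ h * Θ x * x + ρ (h * Θ x * x) = 0) (J' : ℕ) :
    ∑ j ∈ Finset.range (J' + 1), (levelSet ρ Θ α ϖE h j 0).ncard =
      ∑ j ∈ Finset.range (J' + 1), (if j = 0 then 1 else if j % 2 = 1 then 0 else (if 2 * d ≤ j + 1 then 2 else 1) * q ^ (j / 2)) := by
  refine Finset.sum_congr rfl fun j _ => ?_
  rw [ncard_levelSet_ramK_hyper_of_frame hρρ hvρ hΘρ hα1 hα hD hρϖ hΘh hh hq hσres hram hhyper j 0]
  split_ifs <;> first | rfl | omega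

/-- **(T5-P-axis) TYPE RamK, ANISOTROPIC SIDE** — the a = 0 row of ★ `ncard_levelSet_ramK_aniso_of_frame` summed to `J′`: `row⁰(j) = [j = 0] + [j ≥ 2 even, j + 2 ≤ 2d]·q^{j∕2}`. [cite: Flicker1998UnitaryFL, Prop. 7 p. 84] [cite: Jacobowitz1962, §7] -/
theorem sum_ncard_levelSet_zero_eq_ramK_aniso [CompleteSpace K] [IsDiscreteValuationRing 𝒪[K]] [Finite 𝓀[K]]
    (hρρ : ∀ x, ρ (ρ x) = x) (hvρ : ∀ x, Valued.v (ρ x) = Valued.v x) (hΘρ : ∀ x, Θ (ρ x) = ρ (Θ x))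
    (hα1 : Valued.v α ≤ 1) (hα : Valued.v (α - ρ α) = 1) {d t : ℕ} (hD : IsRamifiedQuadraticDatum Θ ϖE d t) (hρϖ : ρ ϖE = ϖE)
    (hΘh : Θ h = h) (hh : h ≠ 0) {q : ℕ} (hq : Nat.card 𝓀[K] = q ^ 2)
    (hσres : ∀ z : K, ρ z = z → Valued.v z ≤ 1 → Valued.v (Θ z - z) < 1) (hram : Valued.v (α - Θ α) < 1)
    (haniso : ¬ ∃ x : K, x ≠ 0 ∧ h * Θ x * x + ρ (h * Θ x * x) = 0) (J' : ℕ) :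
    ∑ j ∈ Finset.range (J' + 1), (levelSet ρ Θ α ϖE h j 0).ncard =
      ∑ j ∈ Finset.range (J' + 1), (if j = 0 then 1 else if j % 2 = 1 then 0 else if j + 2 ≤ 2 * d then q ^ (j / 2) else 0) := by
  refine Finset.sum_congr rfl fun j _ => ?_
  rw [ncard_levelSet_ramK_aniso_of_frame hρρ hvρ hΘρ hα1 hα hD hρϖ hΘh hh hq hσres hram haniso j 0]
  split_ifs <;> first | rfl | omega

/-- **(T5-P-axis) TYPE U (M∕E and K♮∕F unramified), HYPERBOLIC SIDE** — the a = 0 row of ★ `ncard_levelSet_unr_hyper_of_frame` summed to `J′`. [cite: Flicker1998UnitaryFL, Prop. 7 p. 84] [cite: Jacobowitz1962, §7] -/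
theorem sum_ncard_levelSet_zero_eq_unr_hyper {d q : ℕ} [CompleteSpace K] [IsDiscreteValuationRing 𝒪[K]] [Finite 𝓀[K]]
    (hρρ : ∀ x, ρ (ρ x) = x) (hvρ : ∀ x, Valued.v (ρ x) = Valued.v x) (hΘΘ : ∀ x, Θ (Θ x) = x) (hΘρ : ∀ x, Θ (ρ x) = ρ (Θ x))
    (hvΘ : ∀ x, Valued.v (Θ x) = Valued.v x) (hα1 : Valued.v α ≤ 1) (hα : Valued.v (α - ρ α) = 1)
    (hρϖE : ρ ϖE = ϖE) (hϖE : Valued.v ϖE = exp (-1 : ℤ)) (hq : Nat.card 𝓀[K] = q ^ 2)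
    (hτα : Valued.v (ρ α - Θ α) < 1) (hd : 1 ≤ d) (hddE : Valued.v (ϖE - Θ ϖE) = Valued.v ϖE ^ d)
    (hfixE : ∀ z : K, ρ z = z → Θ z = z → z ≠ 0 → ∃ n : ℤ, Valued.v z = exp (2 * n))
    {h : K} (hΘh : Θ h = h) (hh : h ≠ 0) (hhyper : ∃ x : K, x ≠ 0 ∧ h * Θ x * x + ρ (h * Θ x * x) = 0) (J' : ℕ) :
    ∑ j ∈ Finset.range (J' + 1), (levelSet ρ Θ α ϖE h j 0).ncard =
      ∑ j ∈ Finset.range (J' + 1), (if (j + d) % 2 = 0 then (if d ≤ j then (q + 1) * q ^ ((j + d) / 2 - 1) else (if j = 0 then 1 else (q + 1) * q ^ (j - 1))) else 0) := by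
  refine Finset.sum_congr rfl fun j _ => ?_
  rw [ncard_levelSet_unr_hyper_of_frame hρρ hvρ hΘΘ hΘρ hvΘ hα1 hα hρϖE hϖE hq hτα hd hddE hfixE hΘh hh hhyper j 0]
  split_ifs <;> first | rfl | omega

/-- **(T5-P-axis) TYPE U, ANISOTROPIC SIDE** — the a = 0 row of ★ `ncard_levelSet_unr_aniso_of_frame` summed to `J′`. [cite: Flicker1998UnitaryFL, Prop. 7 p. 84] [cite: Jacobowitz1962, §7] -/
theorem sum_ncard_levelSet_zero_eq_unr_aniso {d q : ℕ} [CompleteSpace K] [IsDiscreteValuationRing 𝒪[K]] [Finite 𝓀[K]]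
    (hρρ : ∀ x, ρ (ρ x) = x) (hvρ : ∀ x, Valued.v (ρ x) = Valued.v x) (hΘΘ : ∀ x, Θ (Θ x) = x) (hΘρ : ∀ x, Θ (ρ x) = ρ (Θ x))
    (hvΘ : ∀ x, Valued.v (Θ x) = Valued.v x) (hα1 : Valued.v α ≤ 1) (hα : Valued.v (α - ρ α) = 1)
    (hρϖE : ρ ϖE = ϖE) (hϖE : Valued.v ϖE = exp (-1 : ℤ)) (hq : Nat.card 𝓀[K] = q ^ 2)
    (hτα : Valued.v (ρ α - Θ α) < 1) (hd : 1 ≤ d) (hddE : Valued.v (ϖE - Θ ϖE) = Valued.v ϖE ^ d)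
    (hfixE : ∀ z : K, ρ z = z → Θ z = z → z ≠ 0 → ∃ n : ℤ, Valued.v z = exp (2 * n))
    {h : K} (hΘh : Θ h = h) (hh : h ≠ 0) (haniso : ¬ ∃ x : K, x ≠ 0 ∧ h * Θ x * x + ρ (h * Θ x * x) = 0) (J' : ℕ) :
    ∑ j ∈ Finset.range (J' + 1), (levelSet ρ Θ α ϖE h j 0).ncard =
      ∑ j ∈ Finset.range (J' + 1), (if d = j + 1 ∨ (j + 1 < d ∧ (j + d) % 2 = 1) then (if j = 0 then 1 else (q + 1) * q ^ (j - 1)) else 0) := by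
  refine Finset.sum_congr rfl fun j _ => ?_
  rw [ncard_levelSet_unr_aniso_of_frame hρρ hvρ hΘΘ hΘρ hvΘ hα1 hα hρϖE hϖE hq hτα hd hddE hfixE hΘh hh haniso j 0]
  split_ifs <;> first | rfl | omega

/-- **(T5-P-axis) TYPE RamM, `hnP` SIDE** — the a = 0 row of ★ `ncard_levelSet_eq_hnP` (LH4-p04 (g5) tables; package VERBATIM) summed to `J′`. [cite: Flicker1998UnitaryFL, Prop. 7 p. 84] [cite: Serre1979, Ch. V §3] -/
theorem sum_ncard_levelSet_zero_eq_ramM_hnP {dρ t : ℕ} {K' : Type*} [Field K'] [Valued K' ℤᵐ⁰] {σ' : K' →+* K'} {π' : K'} {d' : ℕ} [CompleteSpace K] [IsDiscreteValuationRing 𝒪[K]] [Finite 𝓀[K]] [IsDiscreteValuationRing 𝒪[K']] [Finite 𝓀[K']]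
    (hD : IsRamifiedQuadraticDatum ρ α dρ t) (hΘρ : ∀ x, Θ (ρ x) = ρ (Θ x)) (hvΘ : ∀ x, Valued.v (Θ x) = Valued.v x)
    (hϖE : Valued.v ϖE = exp (-2 : ℤ)) (hρϖ : ρ ϖE = ϖE) {q : ℕ} (hq : Nat.card 𝓀[K] = q) (hq' : Nat.card 𝓀[K'] = q) (hq2 : 2 ∣ q)
    (hσ' : ∀ x, σ' (σ' x) = x) (hvσ' : ∀ x, Valued.v (σ' x) = Valued.v x) (hfix' : ∀ x : K', σ' x = x → x ≠ 0 → ∃ n : ℤ, Valued.v x = exp (2 * n))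
    (hπ' : Valued.v π' = exp (-1 : ℤ)) (hdd' : Valued.v (π' - σ' π') = Valued.v π' ^ d')
    (jK : K' →+* K) (hjle : ∀ x y : K', Valued.v (jK x) ≤ Valued.v (jK y) ↔ Valued.v x ≤ Valued.v y) (hjΘ : ∀ x, Θ (jK x) = jK x)
    (hjfix : ∀ z : K, Θ z = z → ∃ x, jK x = z) (hjσ : ∀ x, jK (σ' x) = ρ (jK x)) (hjπ : Valued.v (jK π') = exp (-2 : ℤ))
    {ϖ : K} {dΘ tΘ : ℕ} (hDΘ : IsRamifiedQuadraticDatum Θ ϖ dΘ tΘ)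
    (hFN : ∀ f : K, ρ f = f → Θ f = f → Valued.v f = 1 → ∃ x : K, x * Θ x = f)
    (hΘh : Θ h = h) (hh : h ≠ 0) {vh : ℤ} (hvh : Valued.v h = exp (-vh)) {e : ℤ} (he : vh + dρ = 2 * e)
    {g s0 : ℕ} (hg : dΘ = 2 * g) (hds : 2 * d' = dρ + 2 * s0) (hs1 : 1 ≤ s0)
    (hcls0 : ∀ k₀ : ℤ, Valued.v (1 + ρ h / h * (ρ (α ^ k₀ * Θ (α ^ k₀)) / (α ^ k₀ * Θ (α ^ k₀)))) ≤ exp (-(2 * (d' : ℤ) - 2)))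
    (hclsT : ∀ k₀ : ℤ, (∃ r : ℤ, k₀ + s0 + e = 2 * r) → ∃ ω₀ : Kˣ, Valued.v (ω₀ : K) = 1 ∧
      ρ h / h * (ρ (α ^ k₀ * Θ (α ^ k₀)) / (α ^ k₀ * Θ (α ^ k₀))) * (ρ ((ω₀ : K) * Θ ω₀) / ((ω₀ : K) * Θ ω₀)) = -1)
    (hclsO : ∀ k₀ : ℤ, (∃ r : ℤ, k₀ + s0 + e = 2 * r + 1) → ∀ ω : Kˣ, Valued.v (ω : K) = 1 →
      ¬ Valued.v (1 + ρ h / h * (ρ (α ^ k₀ * Θ (α ^ k₀)) / (α ^ k₀ * Θ (α ^ k₀))) * (ρ ((ω : K) * Θ ω) / ((ω : K) * Θ ω))) ≤ exp (-(2 * (d' : ℤ)))) (J' : ℕ) :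
    ∑ j ∈ Finset.range (J' + 1), (levelSet ρ Θ α ϖE h j 0).ncard =
      ∑ j ∈ Finset.range (J' + 1), (if j = 0 then 1 else if j + 1 = s0 then q ^ j else if j + 1 < s0 then q ^ j else if (j - s0) % 2 = 1 then 0 else (if 2 * g ≤ j - s0 then 2 else 1) * q ^ (j - (j - s0) / 2)) := by
  refine Finset.sum_congr rfl fun j _ => ?_
  rw [ncard_levelSet_eq_hnP hD hΘρ hvΘ hϖE hρϖ hq hq' hq2 hσ' hvσ' hfix' hπ' hdd' jK hjle hjΘ hjfix hjσ hjπ hDΘ hFN hΘh hh hvh he hg hds hs1 hcls0 hclsT hclsO j 0]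
  simp only [Nat.sub_zero, Nat.not_lt_zero, ↓reduceIte]

/-- **(T5-P-axis) TYPE RamM, `hnM` SIDE** — the a = 0 row of ★ `ncard_levelSet_eq_hnM` (package VERBATIM) summed to `J′`. [cite: Flicker1998UnitaryFL, Prop. 7 p. 84] [cite: Serre1979, Ch. V §3] -/
theorem sum_ncard_levelSet_zero_eq_ramM_hnM {dρ t : ℕ} {K' : Type*} [Field K'] [Valued K' ℤᵐ⁰] {σ' : K' →+* K'} {π' : K'} {d' : ℕ} [CompleteSpace K] [IsDiscreteValuationRing 𝒪[K]] [Finite 𝓀[K]] [IsDiscreteValuationRing 𝒪[K']] [Finite 𝓀[K']]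
    (hD : IsRamifiedQuadraticDatum ρ α dρ t) (hΘρ : ∀ x, Θ (ρ x) = ρ (Θ x)) (hvΘ : ∀ x, Valued.v (Θ x) = Valued.v x)
    (hϖE : Valued.v ϖE = exp (-2 : ℤ)) (hρϖ : ρ ϖE = ϖE) {q : ℕ} (hq : Nat.card 𝓀[K] = q) (hq' : Nat.card 𝓀[K'] = q)
    (hσ' : ∀ x, σ' (σ' x) = x) (hvσ' : ∀ x, Valued.v (σ' x) = Valued.v x) (hfix' : ∀ x : K', σ' x = x → x ≠ 0 → ∃ n : ℤ, Valued.v x = exp (2 * n))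
    (hπ' : Valued.v π' = exp (-1 : ℤ)) (hdd' : Valued.v (π' - σ' π') = Valued.v π' ^ d')
    (jK : K' →+* K) (hjle : ∀ x y : K', Valued.v (jK x) ≤ Valued.v (jK y) ↔ Valued.v x ≤ Valued.v y) (hjΘ : ∀ x, Θ (jK x) = jK x)
    (hjfix : ∀ z : K, Θ z = z → ∃ x, jK x = z) (hjσ : ∀ x, jK (σ' x) = ρ (jK x)) (hjπ : Valued.v (jK π') = exp (-2 : ℤ))
    {ϖ : K} {dΘ tΘ : ℕ} (hDΘ : IsRamifiedQuadraticDatum Θ ϖ dΘ tΘ)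
    (hFN : ∀ f : K, ρ f = f → Θ f = f → Valued.v f = 1 → ∃ x : K, x * Θ x = f)
    {n₀ : K} (hΘn₀ : Θ n₀ = n₀) (hn₀1 : Valued.v n₀ = 1) (hn₀N : ¬ ∃ z : K, z * Θ z = n₀)
    (hΘh : Θ h = h) (hh : h ≠ 0) {vh : ℤ} (hvh : Valued.v h = exp (-vh)) {e : ℤ} (he : vh + dρ = 2 * e)
    {g s0 : ℕ} (hg : dΘ = 2 * g) (hds : 2 * d' = dρ + 2 * s0) (hs1 : 1 ≤ s0)
    (hcls0 : ∀ k₀ : ℤ, Valued.v (1 + ρ h / h * (ρ (α ^ k₀ * Θ (α ^ k₀)) / (α ^ k₀ * Θ (α ^ k₀)))) ≤ exp (-(2 * (d' : ℤ) - 2)))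
    (hclsE : ∀ k₀ : ℤ, (∃ r : ℤ, k₀ + s0 + e = 2 * r) → ∃ ω₀ : Kˣ, Valued.v (ω₀ : K) = 1 ∧
      ρ h / h * (ρ (α ^ k₀ * Θ (α ^ k₀)) / (α ^ k₀ * Θ (α ^ k₀))) * (ρ ((ω₀ : K) * Θ ω₀) / ((ω₀ : K) * Θ ω₀)) * (ρ n₀ / n₀) = -1)
    (hclsO : ∀ k₀ : ℤ, (∃ r : ℤ, k₀ + s0 + e = 2 * r + 1) → ∀ ω : Kˣ, Valued.v (ω : K) = 1 →
      ¬ Valued.v (1 + ρ h / h * (ρ (α ^ k₀ * Θ (α ^ k₀)) / (α ^ k₀ * Θ (α ^ k₀))) * (ρ ((ω : K) * Θ ω) / ((ω : K) * Θ ω))) ≤ exp (-(2 * (d' : ℤ)))) (J' : ℕ) :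
    ∑ j ∈ Finset.range (J' + 1), (levelSet ρ Θ α ϖE h j 0).ncard =
      ∑ j ∈ Finset.range (J' + 1), (if j = 0 then 1 else if j + 1 = s0 then q ^ j else if j + 1 < s0 then q ^ j else if (j - s0) % 2 = 1 then 0 else if j - s0 + 2 ≤ 2 * g then q ^ (j - (j - s0) / 2) else 0) := by
  refine Finset.sum_congr rfl fun j _ => ?_
  rw [ncard_levelSet_eq_hnM hD hΘρ hvΘ hϖE hρϖ hq hq' hσ' hvσ' hfix' hπ' hdd' jK hjle hjΘ hjfix hjσ hjπ hDΘ hFN hΘn₀ hn₀1 hn₀N hΘh hh hvh he hg hds hs1 hcls0 hclsE hclsO j 0]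
  simp only [Nat.sub_zero, Nat.not_lt_zero, ↓reduceIte]

end Summit.HodgeConjecture.HodgeConjecture.Cruxes.H413.F0P3cDyRamJointProfileCensusAxisTables

end
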